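import Summits.CriticalPhenomena.PercolationContinuityZ3.Theorems.PercNearOneGluingNoHeavyLowerTailSunflowerC1RecursiveSplitting
import Summits.CriticalPhenomena.PercolationContinuityZ3.Theorems.PercNearOneGluingNoHeavyLowerTailSunflowerC1PercolationK4Conn
import HarnessLib

/-!
# `NoHeavyLowerTail` (crux stmt-CriticalPhenomena-4575), abstract sunflower cubic at LAW level: the QUANTILE (three-quarter) recursive Gladkov
# splitting — a second intrinsic sandwich certificate generator for (C1), steered by the depth of the LA / LB deficits of each sub-structure

Support file (seat `prim-ineq-gen-2` gen 35; `--supports stmt-CriticalPhenomena-4575`; `--computational` for the one compiled instance).  No `sorry`,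
no named facts.  As in …SunflowerC1RecursiveSplitting the functions below only PROPOSE a sandwich; soundness is entirely `C1Cert.c1_of_certs`
(…SunflowerC1RegionCertificate), which re-verifies the proposed tables.  Memo: run/shared/lean/prim/prim-ineq-gen-2/INTRINSIC-RULES-GEN35.md §5.

THE RULE (memo §5.6).  Notation of …C1RecursiveSplitting: a sandwich `y : {2-fibres} → [0,1]`, the sub-cube `Q` of a 2-fibre, its own top rows leaving
an interval `[L_Q, U_Q]` for `y(Q)` once the proper sub-cubes carry their values.  The MIDPOINT rule (gen 34, `checkRec`) takes the midpoint; it is valid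
on every structure with ≤ 8 coins tested (≈ 6·10⁸) but fails on a 10-coin structure (w7sub10).  Here the point of the interval is chosen by the DEFICIT
COMPARISON of the sub-structure `θ|Q`: let `m_A(Q) ≤ 0` (`m_B(Q) ≤ 0`) be the minimum of the scaled tensor-Bernstein coefficients of `LA` (`LB`) over all
3-fibres whose top cube is a sub-cube of `Q` (so `m_A(Q) = 0` iff `θ|Q` is additively dominated on the A-side).  Then
  `y(Q) := L + f·(U − L)`,  `f = 0` if `m_A = 0 > m_B` (A-only), `f = 1` if `m_B = 0 > m_A` (B-only), `f = 3/4` if `m_A < m_B < 0`, `f = 1/4` if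
  `m_B < m_A < 0`, `f = 1/2` otherwise (ties, and 'both' `m_A = m_B = 0`)
— the fibre leans toward the side whose cubic form has the SHALLOWER hole, but keeps a quarter of its interval as slack for the petal rows of its
super-structures.  CENSUS (gen 35, exact, C): valid on all 134 'killer' structures of the lineage (w7sub10 and the other 10-coin midpoint failures,
CS(3,3,3), the 8-coin atom sd8 on which the clipped comparison rule fails, q3sub7/8, K33/prism sunflowers, duals), on K₄ / K₄+pendant / W₄ percolation
sunflowers and the cyclic stars CS(2,2,2..2,3,3); wider censuses in the memo.  Nothing is claimed in general: `checkQuant F = true` is a per-structure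
certificate, re-verified by `certSide`.
* `topCube`, `holeInit`, `holeArr` — the per-sub-cube minima `m_A`, `m_B` (a fold over all 3-fibres, then a closure by increasing dimension);
* `quantStep`, `quantWeights` — the recursion (the interval computation is the one of `recStep`);
* `quantTables`, `checkQuant`, **`c1_of_checkQuant`** — tables, the two `certSide` checks, and (C1) at every bias from a successful check;
* instance `k4conn_quant` (compiled): the rule certifies the connected-pair percolation sunflower of `K₄` (…C1PercolationK4Conn).
-/

namespace Summit.CriticalPhenomena.PercolationContinuityZ3.Theorems.SunflowerPartition

namespace SafeCalc

namespace C1Cert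

open Finset Bern

variable {n : ℕ}

/-! ## Deficit minima of all sub-structures -/

/-- Base-3 code of the TOP CUBE of the 3-fibre with base-4 code `a`: digit `2` where `α_i = 3`, `1` where `α_i ∈ {1,2}`, `0` where `α_i = 0`.
[this work] -/
def topCube (n a : ℕ) : ℕ :=
  codeOf n 3 fun i => if digitOf 4 a i == 3 then 2 else if digitOf 4 a i == 0 then 0 else 1

/-- First pass: for every sub-cube code `c`, the minimum (capped at `0`) of the entries of `N` (a table indexed by 3-fibres) over the 3-fibres whose
top cube is exactly `c`. [this work] -/
def holeInit (n : ℕ) (N : Array ℤ) : Array ℤ :=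
  (List.range (4 ^ n)).foldl (fun (m : Array ℤ) a =>
    let c := topCube n a
    let v := N.getD a 0
    if v < m.getD c 0 then m.set! c v else m) (Array.replicate (3 ^ n) (0 : ℤ))

/-- **The deficit minima** `m(Q)`: minimum of `N` over all 3-fibres whose top cube is a SUB-cube of `Q` (closure of `holeInit` by increasing dimension:
a cube inherits the minima of its two facets in every free direction). [this work] -/
def holeArr (n : ℕ) (N : Array ℤ) : Array ℤ :=
  let codes := List.range (3 ^ n)
  (List.range (n + 1)).foldl (fun (m : Array ℤ) d =>
    codes.foldl (fun (m : Array ℤ) c =>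
      if dim3 n c == d then
        (List.range n).foldl (fun (m : Array ℤ) i =>
          if digitOf 3 c i == 1 then
            let v := min (m.getD c 0) (min (m.getD (c - 3 ^ i) 0) (m.getD (c + 3 ^ i) 0))
            m.set! c v
          else m) m
      else m) m) (holeInit n N)

/-! ## The quantile recursion -/

/-- One step: the weight of the sub-cube with base-3 code `c` given the weights `y` of its proper sub-cubes — the interval `[lo, hi]` left by its
top rows (computed exactly as in `recStep`), then the point `lo + f·(hi − lo)` with the fraction `f` chosen by comparing the deficit minima
`mA`, `mB` of the sub-structure (see the file header; if the interval is empty the lower end is returned and the final check fails). [this work] -/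
def quantStep (n : ℕ) (lab : Array ℕ) (g r : Array ℤ) (mA mB : Array ℤ) (y : Array ℚ) (c : ℕ) : ℚ :=
  let S := maskOfDigit n c 2
  let D := maskOfDigit n c 1
  let gQ : ℤ := g.getD c 0
  if gQ ≤ 0 then 0 else
  let subs := subMasks n D
  let bounds : Option ℚ × Option ℚ :=
    subs.foldl (fun (LU : Option ℚ × Option ℚ) V =>
      let rV : ℤ := r.getD (rowCode n S D V) 0
      if rV ≤ 0 then LU else
      let acc : ℚ × ℤ :=
        subs.foldl (fun (tc : ℚ × ℤ) W =>
          let x := S ||| W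
          let ℓ := lab.getD x 9
          if ℓ == 4 || ℓ == 0 then
            let c' := subCode n S D V W
            let g' : ℤ := g.getD c' 0
            if g' ≤ 0 then tc else
            if W == V then
              (if ℓ == 4 then (tc.1 + g', -g') else (tc.1, g'))
            else
              let y' : ℚ := y.getD c' 0
              (if ℓ == 4 then (tc.1 + g' * (1 - y'), tc.2) else (tc.1 + g' * y', tc.2))
          else tc) (0, 0)
      let tot := acc.1
      let coef := acc.2
      if coef < 0 then
        let ub : ℚ := (tot - rV) / gQ
        (LU.1, some (match LU.2 with | none => ub | some u => min u ub))
      else if coef > 0 then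
        let lb : ℚ := (rV - tot) / gQ
        (some (match LU.1 with | none => lb | some l => max l lb), LU.2)
      else LU) (none, none)
  let lo : ℚ := max 0 (bounds.1.getD 0)
  let hi : ℚ := min 1 (bounds.2.getD 1)
  let a : ℤ := mA.getD c 0
  let b : ℤ := mB.getD c 0
  let f : ℚ :=
    if 0 ≤ a ∧ b < 0 then 0
    else if 0 ≤ b ∧ a < 0 then 1
    else if a < b then 3 / 4
    else if b < a then 1 / 4
    else 1 / 2
  if lo ≤ hi then lo + f * (hi - lo) else lo

/-- **The quantile weights** `y(Q)` of all sub-cubes (array indexed by the base-3 code of `β_Q`), computed dimension by dimension, with the deficit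
minima of `LA` and `LB` taken from the scaled tensor-Bernstein coefficient tables of `laArr F`, `lbArr F`. [this work] -/
def quantWeights (F : Sunflower (Fin n)) : Array ℚ :=
  let lab := labCode F
  let g := agBern F
  let r := rBern F
  let mA := holeArr n (bernCoeffsA n 3 (laArr F))
  let mB := holeArr n (bernCoeffsA n 3 (lbArr F))
  let codes := List.range (3 ^ n)
  (List.range (n + 1)).foldl (fun (y : Array ℚ) d =>
    codes.foldl (fun (y : Array ℚ) c => if dim3 n c == d then y.set! c (quantStep n lab g r mA mB y c) else y) y)
    (Array.replicate (3 ^ n) (0 : ℚ))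

/-- Common denominator `N` and the MONOMIAL tables of `N·S` and `N·(AG − S)` for the quantile weights. [this work] -/
def quantTables (F : Sunflower (Fin n)) : ℕ × Array ℤ × Array ℤ :=
  let g := agBern F
  let y := quantWeights F
  let N : ℕ := y.foldl (fun acc q => Nat.lcm acc q.den) 1
  let wA : Array ℤ := (Array.range (3 ^ n)).map fun c => (((N : ℚ) * y.getD c 0) * (g.getD c 0 : ℚ)).num
  let wB : Array ℤ := (Array.range (3 ^ n)).map fun c => (((N : ℚ) * (1 - y.getD c 0)) * (g.getD c 0 : ℚ)).num
  (N, backLA n 2 (List.finRange n) wA, backLA n 2 (List.finRange n) wB)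

/-- **The data-free (C1) check by the quantile splitting**: the two Bernstein region certificates with `S₁ = N·S` (A-side) and `S₁' = N·(AG − S)`
(B-side), `S₂ = 0`, scale `N`. [this work] -/
def checkQuant (F : Sunflower (Fin n)) : Bool :=
  let t := quantTables F
  certSide n (laArr F) (dArr F) t.1 t.2.1 (zeroArr n 1) && certSide n (lbArr F) (ndArr F) t.1 t.2.2 (zeroArr n 1)

/-- **(C1) from the quantile splitting check**: if `checkQuant F` evaluates to `true` then `e₃(c) ≤ max(a,b)·(ab − e₂(c))` for the cell masses of
`F` at every bias `x ∈ [0,1]^n`. [this work] -/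
theorem c1_of_checkQuant (F : Sunflower (Fin n)) (h : checkQuant F = true) (x : Fin n → ℝ) (hx : ∀ i, 0 ≤ x i ∧ x i ≤ 1) :
    cellMass F 1 x * cellMass F 2 x * cellMass F 3 x ≤
      max (cellMass F 4 x) (cellMass F 0 x) *
        (cellMass F 4 x * cellMass F 0 x
          - (cellMass F 1 x * cellMass F 2 x + cellMass F 1 x * cellMass F 3 x + cellMass F 2 x * cellMass F 3 x)) := by
  simp only [checkQuant, Bool.and_eq_true] at h
  exact c1_of_certs F h.1 h.2 x hx

/-- **The conjecture, as a `Prop`** (memo gen 35 §5; census-true on every structure tested, OPEN): the quantile rule certifies every three-petal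
sunflower of up-sets. [this work] -/
def QuantileSplittingConjecture : Prop := ∀ (n : ℕ) (F : Sunflower (Fin n)), checkQuant F = true

/-- The conjecture implies (C1) for every sunflower at every bias. [this work] -/
theorem c1_of_quantileSplittingConjecture (h : QuantileSplittingConjecture) {n : ℕ} (F : Sunflower (Fin n)) (x : Fin n → ℝ)
    (hx : ∀ i, 0 ≤ x i ∧ x i ≤ 1) :
    cellMass F 1 x * cellMass F 2 x * cellMass F 3 x ≤
      max (cellMass F 4 x) (cellMass F 0 x) *
        (cellMass F 4 x * cellMass F 0 x
          - (cellMass F 1 x * cellMass F 2 x + cellMass F 1 x * cellMass F 3 x + cellMass F 2 x * cellMass F 3 x)) :=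
  c1_of_checkQuant F (h n F) x hx

/-! ## A compiled instance -/

/-- The quantile rule certifies the connected-pair percolation sunflower of `K₄` (compiled check). [this work] -/
theorem k4conn_quant : checkQuant k4conn = true := by native_decide

end C1Cert

end SafeCalc

end Summit.CriticalPhenomena.PercolationContinuityZ3.Theorems.SunflowerPartition
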